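import Mathlib
import Summits.NavierStokesRegularity.NavierStokesRegularity.Theses.FilamentSkeletonRss
import Summits.NavierStokesRegularity.NavierStokesRegularity.Theorems.FilamentSkeletonRssCoreGluingSplit
import Summits.NavierStokesRegularity.NavierStokesRegularity.Theorems.FilamentSkeletonRssCoreGluingRouteReduction
import Summits.NavierStokesRegularity.NavierStokesRegularity.Theorems.FilamentSkeletonRssCoreLinearInvertibility

/-!
# Route `FilamentSkeletonRss` · crux `CoreGluing` (stmt-NavierStokesRegularity-15401) — the split glue on the REPAIRED (rev-9) children

Route rev 9 (route-repair rrefute-…-ae35ae51, 2026-08-17T18:22Z) restated the two quantitative children of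
`CoreGluing` after `TransverseReduction` (stmt-18688) was refuted-MISSTATED by the far-field circulation law
(axis-parallel stagnation cores have accretion scalar ≡ 0): `SelectionBoxR` (stmt-19174) and
`TransverseReductionR` (stmt-19175) carry ONE new margin `θ₀ > 0` (tilt `|⟪X′_j(c_j), e₃⟫| ≤ 1 − θ₀` and bounds
`θ₀ ≤ |α|, |γ_j| ≤ θ₀⁻¹`), the box blocks being textually identical in both; `CoreGluingGivenInvertibilityQR :=
CoreLinearInvertibility → TransverseReductionR` (stmt-19176); `BoxSelectionR := SelectionBoxR → TransverseReductionR →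
RssProfileExists` (stmt-19177).  The retired decls `SelectionBox` / `TransverseReduction` /
`CoreGluingGivenInvertibilityQ` / `BoxSelection` are gone from the route file.

This file (lead c13 of the held parent `CoreGluing`, line `invertibility-split` reshape 3) re-threads the landed
selection glue `rssProfileExists_of_selectionBox_transverseReduction` (p153006: opposite face signs ⇒ Poincaré–Miranda
zero `p⋆` of the sign-normalised accretion map ⇒ exact profile `U_{p⋆}` ⇒ `stub_rssProfileExists_of_profile`) through
the two new binders, with the hypotheses now the route decls BY NAME, and records the item graph after the linear
input `CoreLinearInvertibility` (stmt-17973) became a theorem (`coreLinearInvertibility_proof`, p171932):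
`CoreGluingGivenInvertibilityQR ↔ TransverseReductionR`, `CoreGluingGivenInvertibility ↔ CoreGluing`, and
`SelectionBoxR → CoreGluingGivenInvertibilityQR → CoreGluing / RssProfileExists / ¬NavierStokesRegularity` — after
p171932 the route's deciding theorem needs exactly stmt-19174 and stmt-19176 (≡ stmt-19175).
-/

set_option linter.dupNamespace false

noncomputable section

namespace Summit.NavierStokesRegularity.NavierStokesRegularity.Theorems

open Set Function Filter MeasureTheory Real
open Literature.Analysis.FluidPDE Literature.Analysis.FluidPDE.PineauVicol2026
open Summit.NavierStokesRegularity.NavierStokesRegularity.Theses.FilamentSkeletonRss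
open scoped RealInnerProductSpace Laplacian ContDiff Topology

/-- **The two repaired children give the route TARGET**: `SelectionBoxR → TransverseReductionR → RssProfileExists`.
Proof = p153006 with `θ₀`/`hθ₀` threaded: the box at `Γ = max Γ₁ Γ₂` carries a reduced family `(U, P, B)`
(transverse reduction); the sign law gives opposite strict signs of `B_{·} j` on the faces `p_j = 0 / 1`;
Poincaré–Miranda (`stub_poincareMiranda`, p139006) on the sign-normalised map `p ↦ (B₁ⱼ · B_p j)_j` yields `p⋆`
with `B_{p⋆} = 0`, i.e. an exact smooth decaying rotated-Leray profile, which `stub_rssProfileExists_of_profile`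
(p130189) packages as `RssProfileExists`. [folklore] -/
theorem rssProfileExists_of_selectionBoxR_transverseReductionR (hbox : SelectionBoxR)
    (hred : TransverseReductionR) : RssProfileExists := by
  classical
  obtain ⟨N, δ, ρ, K, Λ, a, b, cnd, η, Rw, Rb, cg, θ₀, Γ₂, hN, hδ, hρ, _hcnd, hη, hRw, hRb, hcg, hθ₀, hbox⟩ :=
    hbox
  obtain ⟨Γ₁, hred⟩ := hred N δ ρ K Λ a b cnd η Rw Rb cg θ₀ hN hδ hρ hη hRw hRb hcg hθ₀
  obtain ⟨γ, α, X, w, c, m, n, hfam⟩ := hbox (max Γ₁ Γ₂) (le_max_right _ _)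
  -- the derived objects of the skeleton box at circulation `Γ = max Γ₁ Γ₂`
  set Γ : ℝ := max Γ₁ Γ₂
  set u : (Fin N → ℝ) → (Fin N → ℝ → EuclideanSpace ℝ (Fin 3)) → EuclideanSpace ℝ (Fin 3) →
      EuclideanSpace ℝ (Fin 3) := fun p Z y => ∑ k : Fin N, (Γ * γ p k / (4 * π)) • ∫ σ : ℝ,
        ((‖y - Z k σ‖ ^ 2 + 1) ^ (3 / 2 : ℝ))⁻¹ • cross (deriv (Z k) σ) (y - Z k σ)
  set v : (Fin N → ℝ) → EuclideanSpace ℝ (Fin 3) → EuclideanSpace ℝ (Fin 3) :=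
    fun p y => u p (X p) y + (1 / 2 : ℝ) • y - α p • cross (EuclideanSpace.single (2 : Fin 3) (1 : ℝ)) y
  set A : (Fin N → ℝ) → Fin N → (EuclideanSpace ℝ (Fin 3) →L[ℝ] EuclideanSpace ℝ (Fin 3)) :=
    fun p j => fderiv ℝ (v p) (X p j (c p j))
  set T : (Fin N → ℝ) → (Fin N → ℝ → EuclideanSpace ℝ (Fin 3)) → Fin N → ℝ →
      EuclideanSpace ℝ (Fin 3) :=
    fun p Z j τ => (u p Z (Z j τ) + (1 / 2 : ℝ) • Z j τ - α p • cross (EuclideanSpace.single (2 : Fin 3) (1 : ℝ)) (Z j τ)) -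
      (inner ℝ (u p Z (Z j τ) + (1 / 2 : ℝ) • Z j τ - α p • cross (EuclideanSpace.single (2 : Fin 3) (1 : ℝ)) (Z j τ)) (deriv (Z j) τ) /
        ‖deriv (Z j) τ‖ ^ 2) • deriv (Z j) τ
  set D : (Fin N → ℝ) → Fin N → EuclideanSpace ℝ (Fin 3) → EuclideanSpace ℝ (Fin 3) :=
    fun p j y => (Real.exp (-(inner ℝ (y - X p j (c p j)) (deriv (X p j) (c p j))) ^ 2) *
      ((1 - Real.exp (-(‖y - X p j (c p j)‖ ^ 2 -
        inner ℝ (y - X p j (c p j)) (deriv (X p j) (c p j)) ^ 2))) /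
        (‖y - X p j (c p j)‖ ^ 2 - inner ℝ (y - X p j (c p j)) (deriv (X p j) (c p j)) ^ 2))) •
      cross (deriv (X p j) (c p j)) (y - X p j (c p j))
  obtain ⟨⟨hcont, hskel⟩, hsign⟩ := hfam u v A T D (fun _ _ _ => rfl) (fun _ _ => rfl)
    (fun _ _ => rfl) (fun _ _ _ _ => rfl) (fun _ _ _ => rfl)
  obtain ⟨C₀, M, U, P, B, hUPB⟩ := hred Γ (le_max_left _ _) γ α X w c m n u v A T D
    (fun _ _ _ => rfl) (fun _ _ => rfl) (fun _ _ => rfl) (fun _ _ _ _ => rfl) (fun _ _ _ => rfl)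
    ⟨hcont, hskel⟩
  have hs := hsign C₀ M U P B hUPB
  obtain ⟨hBcont, hfamU⟩ := hUPB
  -- the corner `(1,…,1)` and the face points `(1,…,0,…,1)`
  set one : Fin N → ℝ := fun _ => 1
  have hone_mem : ∀ i, one i ∈ Icc (0:ℝ) 1 := fun _ => ⟨zero_le_one, le_rfl⟩
  have hupd_mem : ∀ j i, Function.update one j 0 i ∈ Icc (0:ℝ) 1 := by
    intro j i
    rcases eq_or_ne i j with rfl | h
    · simp
    · rw [Function.update_of_ne h]; exact hone_mem i
  -- `B one j ≠ 0`, and the signs on the two faces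
  have hface0 : ∀ j (p : Fin N → ℝ), (∀ i, p i ∈ Icc (0:ℝ) 1) → p j = 0 → B p j * B one j < 0 :=
    fun j p hp hpj => hs j p one hp hone_mem hpj rfl
  have hone_ne : ∀ j, B one j ≠ 0 := by
    intro j h0
    have := hface0 j (Function.update one j 0) (hupd_mem j) (by simp)
    rw [h0, mul_zero] at this
    exact lt_irrefl _ this
  have hface1 : ∀ j (q : Fin N → ℝ), (∀ i, q i ∈ Icc (0:ℝ) 1) → q j = 1 → 0 < B one j * B q j := by
    intro j q hq hqj
    have h1 : B (Function.update one j 0) j * B q j < 0 :=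
      hs j (Function.update one j 0) q (hupd_mem j) hq (by simp) hqj
    have h2 : B (Function.update one j 0) j * B one j < 0 :=
      hface0 j (Function.update one j 0) (hupd_mem j) (by simp)
    rcases mul_neg_iff.1 h1 with ⟨ha, hb⟩ | ⟨ha, hb⟩
    · rcases mul_neg_iff.1 h2 with ⟨_, hb'⟩ | ⟨ha', _⟩
      · exact mul_pos_of_neg_of_neg hb' hb
      · exact absurd ha (not_lt.2 ha'.le)
    · rcases mul_neg_iff.1 h2 with ⟨ha', _⟩ | ⟨_, hb'⟩
      · exact absurd ha (not_lt.2 ha'.le)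
      · exact mul_pos hb' hb
  -- the sign-normalised accretion map and Poincaré–Miranda
  set f : (Fin N → ℝ) → Fin N → ℝ := fun p j => B one j * B p j
  have hfcont : ContinuousOn f {p : Fin N → ℝ | ∀ i, p i ∈ Icc (0:ℝ) 1} :=
    continuousOn_pi.2 fun j => continuousOn_const.mul ((continuousOn_pi.1 hBcont) j)
  obtain ⟨ps, hps, hzero⟩ := stub_poincareMiranda N f hfcont
    (fun p hp j hpj => by
      have := hface0 j p hp hpj
      show B one j * B p j ≤ 0
      rw [mul_comm]; exact this.le)
    (fun q hq j hqj => (hface1 j q hq hqj).le)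
  have hB0 : ∀ j, B ps j = 0 := fun j =>
    (mul_eq_zero.1 (hzero j)).resolve_left (hone_ne j)
  -- the selected member of the reduced family is an exact profile
  obtain ⟨hU0, hUs, hPs, hdiv, heq, hdec, hPM, -⟩ := hfamU ps hps
  have heq0 : ∀ y : EuclideanSpace ℝ (Fin 3), α ps • (rotGen (U ps y) - fderiv ℝ (U ps) y (rotGen y)) +
      (1 / 2 : ℝ) • U ps y + (1 / 2 : ℝ) • fderiv ℝ (U ps) y y - (Δ (U ps)) y +
      fderiv ℝ (U ps) y (U ps y) + gradient (P ps) y = 0 := by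
    intro y
    simp only [splitGlue_rotGen_eq_cross_single_two]
    rw [heq y]
    simp [hB0]
  exact stub_rssProfileExists_of_profile
    ⟨α ps, C₀, M, U ps, P ps, (hskel ps hps).1, hU0, hUs, hPs, hdiv, heq0, hdec, hPM⟩

/-- **Split glue of the held parent on the repaired children**: `SelectionBoxR → TransverseReductionR → CoreGluing`
(the hypothesis `SkeletonEquilibrium` of `CoreGluing` is not consumed). [folklore] -/
theorem coreGluing_of_selectionBoxR_transverseReductionR (hbox : SelectionBoxR)
    (hred : TransverseReductionR) : CoreGluing :=
  fun _ => rssProfileExists_of_selectionBoxR_transverseReductionR hbox hred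

/-- With the linear input proved (`coreLinearInvertibility_proof`, p171932) the re-wired gluing item
`CoreGluingGivenInvertibilityQR := CoreLinearInvertibility → TransverseReductionR` (stmt-19176) is EQUIVALENT to
`TransverseReductionR` (stmt-19175): one statement in two spellings. [folklore] -/
theorem coreGluingGivenInvertibilityQR_iff_transverseReductionR :
    CoreGluingGivenInvertibilityQR ↔ TransverseReductionR :=
  ⟨fun hQ => hQ coreLinearInvertibility_proof, fun hT _ => hT⟩

/-- With the linear input proved (p171932) the held child `CoreGluingGivenInvertibility :=
CoreLinearInvertibility → CoreGluing` (stmt-17944) is EQUIVALENT to the held parent `CoreGluing` (stmt-15401).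
[folklore] -/
theorem coreGluingGivenInvertibility_iff_coreGluing :
    CoreGluingGivenInvertibility ↔ CoreGluing :=
  ⟨fun h => h coreLinearInvertibility_proof, fun h _ => h⟩

/-- **The target from the two open rev-9 cruxes**: `SelectionBoxR → CoreGluingGivenInvertibilityQR →
RssProfileExists`. [folklore] -/
theorem rssProfileExists_of_selectionBoxR_coreGluingGivenInvertibilityQR (hbox : SelectionBoxR)
    (hQ : CoreGluingGivenInvertibilityQR) : RssProfileExists :=
  rssProfileExists_of_selectionBoxR_transverseReductionR hbox
    (coreGluingGivenInvertibilityQR_iff_transverseReductionR.mp hQ)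

/-- **The held parent from the two open rev-9 cruxes**: `SelectionBoxR → CoreGluingGivenInvertibilityQR → CoreGluing`
— the composition `CoreGluing_of` of line `invertibility-split` (reshape 3) with both stubs as hypotheses. [folklore] -/
theorem coreGluing_of_selectionBoxR_coreGluingGivenInvertibilityQR (hbox : SelectionBoxR)
    (hQ : CoreGluingGivenInvertibilityQR) : CoreGluing :=
  fun _ => rssProfileExists_of_selectionBoxR_coreGluingGivenInvertibilityQR hbox hQ

/-- The held child likewise: `SelectionBoxR → CoreGluingGivenInvertibilityQR → CoreGluingGivenInvertibility`
(stmt-17944 closes with stmt-15401). [folklore] -/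
theorem coreGluingGivenInvertibility_of_selectionBoxR_coreGluingGivenInvertibilityQR (hbox : SelectionBoxR)
    (hQ : CoreGluingGivenInvertibilityQR) : CoreGluingGivenInvertibility :=
  coreGluingGivenInvertibility_iff_coreGluing.mpr
    (coreGluing_of_selectionBoxR_coreGluingGivenInvertibilityQR hbox hQ)

/-- **The summit's negative side from the two open rev-9 cruxes**: `SelectionBoxR →
CoreGluingGivenInvertibilityQR → ¬ NavierStokesRegularity` — the selected RSS field is truncated by the proved bridge
`RdssProfileTruncation` and contradicts Clay (A) via the proved Clay-class uniqueness (route reduction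
`rssProfileExists_not_navierStokesRegularity`, p134409).  After p171932 this is the whole route. [folklore] -/
theorem not_navierStokesRegularity_of_selectionBoxR_coreGluingGivenInvertibilityQR (hbox : SelectionBoxR)
    (hQ : CoreGluingGivenInvertibilityQR) : ¬ _root_.NavierStokesRegularity :=
  rssProfileExists_not_navierStokesRegularity
    (rssProfileExists_of_selectionBoxR_coreGluingGivenInvertibilityQR hbox hQ)

/-- The same with `TransverseReductionR` (stmt-19175) in place of its rev-9 spelling:
`SelectionBoxR → TransverseReductionR → ¬ NavierStokesRegularity`. [folklore] -/
theorem not_navierStokesRegularity_of_selectionBoxR_transverseReductionR (hbox : SelectionBoxR)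
    (hred : TransverseReductionR) : ¬ _root_.NavierStokesRegularity :=
  rssProfileExists_not_navierStokesRegularity (rssProfileExists_of_selectionBoxR_transverseReductionR hbox hred)

/-- Registered tools stub `stub_splitRGlueTools` of stmt-NavierStokesRegularity-15401 (line `invertibility-split`, reshape 3;
`ledger workitem stub-add … --name stub_splitRGlueTools`): the rev-9 selection glue and the post-p171932 item graph of this file
in one conjunction — target / parent from the two repaired children, `QR ↔ TransverseReductionR`, `CGGI ↔ CoreGluing`, parent and
`¬NavierStokesRegularity` from the two open rev-9 cruxes. [folklore] -/
theorem stub_splitRGlueTools :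
    (Summit.NavierStokesRegularity.NavierStokesRegularity.Theses.FilamentSkeletonRss.SelectionBoxR → Summit.NavierStokesRegularity.NavierStokesRegularity.Theses.FilamentSkeletonRss.TransverseReductionR → Summit.NavierStokesRegularity.NavierStokesRegularity.Theses.FilamentSkeletonRss.RssProfileExists) ∧ (Summit.NavierStokesRegularity.NavierStokesRegularity.Theses.FilamentSkeletonRss.SelectionBoxR → Summit.NavierStokesRegularity.NavierStokesRegularity.Theses.FilamentSkeletonRss.TransverseReductionR → Summit.NavierStokesRegularity.NavierStokesRegularity.Theses.FilamentSkeletonRss.CoreGluing) ∧ (Summit.NavierStokesRegularity.NavierStokesRegularity.Theses.FilamentSkeletonRss.CoreGluingGivenInvertibilityQR ↔ Summit.NavierStokesRegularity.NavierStokesRegularity.Theses.FilamentSkeletonRss.TransverseReductionR) ∧ (Summit.NavierStokesRegularity.NavierStokesRegularity.Theses.FilamentSkeletonRss.CoreGluingGivenInvertibility ↔ Summit.NavierStokesRegularity.NavierStokesRegularity.Theses.FilamentSkeletonRss.CoreGluing) ∧ (Summit.NavierStokesRegularity.NavierStokesRegularity.Theses.FilamentSkeletonRss.SelectionBoxR →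 Summit.NavierStokesRegularity.NavierStokesRegularity.Theses.FilamentSkeletonRss.CoreGluingGivenInvertibilityQR → Summit.NavierStokesRegularity.NavierStokesRegularity.Theses.FilamentSkeletonRss.CoreGluing) ∧ (Summit.NavierStokesRegularity.NavierStokesRegularity.Theses.FilamentSkeletonRss.SelectionBoxR → Summit.NavierStokesRegularity.NavierStokesRegularity.Theses.FilamentSkeletonRss.CoreGluingGivenInvertibilityQR → ¬ _root_.NavierStokesRegularity) :=
  ⟨rssProfileExists_of_selectionBoxR_transverseReductionR, coreGluing_of_selectionBoxR_transverseReductionR,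
    coreGluingGivenInvertibilityQR_iff_transverseReductionR, coreGluingGivenInvertibility_iff_coreGluing,
    coreGluing_of_selectionBoxR_coreGluingGivenInvertibilityQR,
    not_navierStokesRegularity_of_selectionBoxR_coreGluingGivenInvertibilityQR⟩

end Summit.NavierStokesRegularity.NavierStokesRegularity.Theorems

end
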